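import Literature.Computability.Complexity.GenPrograms
import Literature.Computability.Complexity.StackArith
import HarnessLib

/-!
# Token streams with binary numerals: generator programs print descriptions in `FP`

Trunk `CplxCore`, toolkit for uniformity proofs, continuing `GenPrograms.lean`. A generator
program (`GStmt`: literal emission inside nested counted loops with polynomial bounds) can only
write numbers in *unary* (`loop i e (emit [tick])`), whereas the descriptions of circuits used
in the tree (`QCircuit.sigmaEncode`, `boolPair`, `Computability.encodeNat`) write wire indices
in *binary*. This file closes the gap once and for all with a second, fixed polynomial-time pass:

* `Tok` — the token alphabet `lit b | tick | dump b₁ b₀` with its three-bit code `Tok.code`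
  and the total decoder `Tok.decode` (`decode_code`);
* `Tok.render c ts` — **the rendering**: a counter `c` is incremented by `tick`; `dump b₁ b₀`
  writes every bit of the binary numeral `encodeNat c` (least significant first, Mathlib's
  `Computability.encodeNat`) `mult b₁ b₀ ∈ {1, 2, 3, 4}` times and resets the counter; `lit b`
  writes `b`. So `replicate w tick ++ [dump b₁ b₀]` renders the (repeated-bit) binary numeral
  of `w` (`render_numeral`), and rendering is compositional on blocks that reset the counter
  (`Tok.fin`, `render_append`);
* `TokConv.conv` — the converter, a structured stack program (`StackPrograms.lean`): a binary
  counter register incremented by a full carry pass (`TokConv.inc`, `runs_inc`,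
  `encodeNat_succ_eq_incRes`), dumping by a destructive loop (`runs_dump`), dispatch on the
  three code bits (`runs_mainLoop`); its cost is quadratic (`mainCost_le`);
* `Tok.render_decode_mem_FP` — `z ↦ render 0 (decode z)` is in `FP` (`Com.mem_FP`);
* `GStmt.render_out_mem_FP` — **for every generator program `s` over `Tok`, the rendered
  stream `z ↦ render 0 (out s (x₀ ↦ |z|))` is in `FP`** (`GStmt.out_mem_FP` composed with the
  converter by `PolyTimeComputable.comp_holds`).

With `QCircuitFamily.isUniform_of_mem_FP` this reduces the uniformity of a circuit family to
writing a generator program and proving a *list identity* between its rendered stream and the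
description (Arora–Barak 2009, §6.2 and proof of Thm. 6.15: "output the description gate by
gate, keeping counters"; the binary numerals of the counters are what this file supplies).

## References

* S. Arora, B. Barak, *Computational Complexity: A Modern Approach*, CUP 2009, §0.1
  (representations: binary numerals, pairing), §1.3, §6.2 and Thm. 6.15.
* D. E. Knuth, *The Art of Computer Programming*, Vol. 2, 3rd ed. 1998, §4.3.1 (binary
  increment with carry propagation). (Not held; schoolbook, fully proved here.)
* T. Nipkow, G. Klein, *Concrete Semantics with Isabelle/HOL*, Springer 2014, Ch. 7.
-/

namespace Literature.Computability.Complexity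

open _root_.Computability

/-! ### Tokens, rendering, coding -/

/-- Tokens of description streams: a literal bit, a counter tick, and a dump of the counter in
binary with bit multiplicity `mult b₁ b₀`. [folklore] -/
inductive Tok where
  /-- emit the bit `b` -/
  | lit (b : Bool)
  /-- increment the counter -/
  | tick
  /-- emit the binary numeral of the counter, every bit `2 b₁ + b₀ + 1` times, and reset -/
  | dump (b₁ b₀ : Bool)
  deriving DecidableEq

namespace Tok

/-- The bit multiplicity of a dump token: `2 b₁ + b₀ + 1 ∈ {1, 2, 3, 4}`. [folklore] -/
def mult (b₁ b₀ : Bool) : ℕ := 2 * b₁.toNat + b₀.toNat + 1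

/-- `mult 0 0 = 1`. [folklore] -/ @[simp] theorem mult_ff : mult false false = 1 := rfl
/-- `mult 0 1 = 2`. [folklore] -/ @[simp] theorem mult_ft : mult false true = 2 := rfl
/-- `mult 1 0 = 3`. [folklore] -/ @[simp] theorem mult_tf : mult true false = 3 := rfl
/-- `mult 1 1 = 4`. [folklore] -/ @[simp] theorem mult_tt : mult true true = 4 := rfl

/-- `mult ≤ 4`. [folklore] -/
theorem mult_le (b₁ b₀ : Bool) : mult b₁ b₀ ≤ 4 := by
  cases b₁ <;> cases b₀ <;> simp [mult]

/-- The binary numeral of `c` (least significant bit first) with every bit repeated `m` times.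
[Arora–Barak 2009, §0.1] [folklore] -/
def numeral (m c : ℕ) : List Bool := (encodeNat c).flatMap fun b => List.replicate m b

/-- **Rendering** a token stream from counter value `c`. [folklore] -/
def render : ℕ → List Tok → List Bool
  | _, [] => []
  | c, lit b :: ts => b :: render c ts
  | c, tick :: ts => render (c + 1) ts
  | c, dump b₁ b₀ :: ts => numeral (mult b₁ b₀) c ++ render 0 ts

/-- The counter after rendering a stream from counter value `c`. [folklore] -/
def fin : ℕ → List Tok → ℕ
  | c, [] => c
  | c, lit _ :: ts => fin c ts
  | c, tick :: ts => fin (c + 1) ts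
  | _, dump _ _ :: ts => fin 0 ts

/-- `render` of the empty stream. [folklore] -/
@[simp] theorem render_nil (c : ℕ) : render c [] = [] := rfl
/-- `render` of a literal. [folklore] -/
@[simp] theorem render_lit (c : ℕ) (b : Bool) (ts : List Tok) :
    render c (lit b :: ts) = b :: render c ts := rfl
/-- `render` of a tick. [folklore] -/
@[simp] theorem render_tick (c : ℕ) (ts : List Tok) : render c (tick :: ts) = render (c + 1) ts := rfl
/-- `render` of a dump. [folklore] -/
@[simp] theorem render_dump (c : ℕ) (b₁ b₀ : Bool) (ts : List Tok) :
    render c (dump b₁ b₀ :: ts) = numeral (mult b₁ b₀) c ++ render 0 ts := rfl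
/-- `fin` of the empty stream. [folklore] -/
@[simp] theorem fin_nil (c : ℕ) : fin c [] = c := rfl
/-- `fin` of a literal. [folklore] -/
@[simp] theorem fin_lit (c : ℕ) (b : Bool) (ts : List Tok) : fin c (lit b :: ts) = fin c ts := rfl
/-- `fin` of a tick. [folklore] -/
@[simp] theorem fin_tick (c : ℕ) (ts : List Tok) : fin c (tick :: ts) = fin (c + 1) ts := rfl
/-- `fin` of a dump. [folklore] -/
@[simp] theorem fin_dump (c : ℕ) (b₁ b₀ : Bool) (ts : List Tok) :
    fin c (dump b₁ b₀ :: ts) = fin 0 ts := rfl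

/-- **Rendering is compositional**: the second block is rendered from the final counter of the
first. [folklore] -/
theorem render_append : ∀ (c : ℕ) (A B : List Tok),
    render c (A ++ B) = render c A ++ render (fin c A) B
  | _, [], _ => rfl
  | c, lit b :: A, B => by simp [render_append c A B]
  | c, tick :: A, B => by simp [render_append (c + 1) A B]
  | c, dump b₁ b₀ :: A, B => by simp [render_append 0 A B]

/-- The final counter of a concatenation. [folklore] -/
theorem fin_append : ∀ (c : ℕ) (A B : List Tok), fin c (A ++ B) = fin (fin c A) B
  | _, [], _ => rfl
  | c, lit b :: A, B => by simp [fin_append c A B]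
  | c, tick :: A, B => by simp [fin_append (c + 1) A B]
  | c, dump b₁ b₀ :: A, B => by simp [fin_append 0 A B]

/-- A run of ticks adds to the counter and renders nothing. [folklore] -/
theorem render_replicate_tick : ∀ (w c : ℕ) (B : List Tok),
    render c (List.replicate w tick ++ B) = render (c + w) B
  | 0, c, B => by simp
  | w + 1, c, B => by
    rw [List.replicate_succ, List.cons_append, render_tick, render_replicate_tick w]
    congr 1; omega

/-- A run of ticks adds to the counter. [folklore] -/
theorem fin_replicate_tick : ∀ (w c : ℕ) (B : List Tok),
    fin c (List.replicate w tick ++ B) = fin (c + w) B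
  | 0, c, B => by simp
  | w + 1, c, B => by
    rw [List.replicate_succ, List.cons_append, fin_tick, fin_replicate_tick w]
    congr 1; omega

/-- **Numerals**: `w` ticks followed by a dump render, from counter `0`, the binary numeral of
`w` with bit multiplicity `mult b₁ b₀`. [Arora–Barak 2009, §0.1] [folklore] -/
theorem render_numeral (w : ℕ) (b₁ b₀ : Bool) (B : List Tok) :
    render 0 (List.replicate w tick ++ dump b₁ b₀ :: B) = numeral (mult b₁ b₀) w ++ render 0 B := by
  rw [render_replicate_tick, Nat.zero_add, render_dump]

/-- Numerals reset the counter. [folklore] -/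
theorem fin_numeral (w c : ℕ) (b₁ b₀ : Bool) (B : List Tok) :
    fin c (List.replicate w tick ++ dump b₁ b₀ :: B) = fin 0 B := by
  rw [fin_replicate_tick, fin_dump]

/-- Literal words render verbatim. [folklore] -/
theorem render_map_lit (c : ℕ) (bs : List Bool) (B : List Tok) :
    render c (bs.map lit ++ B) = bs ++ render c B := by
  induction bs with
  | nil => rfl
  | cons b bs ih => simp [ih]

/-- Literal words keep the counter. [folklore] -/
theorem fin_map_lit (c : ℕ) (bs : List Bool) (B : List Tok) : fin c (bs.map lit ++ B) = fin c B := by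
  induction bs with
  | nil => rfl
  | cons b bs ih => simp [ih]

/-- The three-bit code: `lit b ↦ 00b`, `tick ↦ 010`, `dump b₁ b₀ ↦ 1 b₁ b₀` (`011` unused).
[folklore] -/
def code : Tok → List Bool
  | lit b => [false, false, b]
  | tick => [false, true, false]
  | dump b₁ b₀ => [true, b₁, b₀]

/-- Every code word has three bits. [folklore] -/
@[simp] theorem length_code (τ : Tok) : (code τ).length = 3 := by cases τ <;> rfl

/-- The token(s) of a three-bit block (`011 ↦` nothing). [folklore] -/
def tokOf : Bool → Bool → Bool → List Tok
  | false, false, b => [lit b]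
  | false, true, false => [tick]
  | false, true, true => []
  | true, b₁, b₀ => [dump b₁ b₀]

/-- The total decoder: read three bits at a time, drop an incomplete final block. [folklore] -/
def decode : List Bool → List Tok
  | a :: b :: d :: z => tokOf a b d ++ decode z
  | _ => []

/-- Decoding a block. [folklore] -/
theorem decode_cons₃ (a b d : Bool) (z : List Bool) : decode (a :: b :: d :: z) = tokOf a b d ++ decode z :=
  rfl

/-- **The decoder inverts the code.** [folklore] -/
theorem decode_code (ts : List Tok) : decode (ts.flatMap code) = ts := by
  induction ts with
  | nil => rfl
  | cons τ ts ih =>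
    rw [List.flatMap_cons]
    cases τ with
    | lit b => simpa [code, decode_cons₃, tokOf] using ih
    | tick => simpa [code, decode_cons₃, tokOf] using ih
    | dump b₁ b₀ => cases b₁ <;> cases b₀ <;> simpa [code, decode_cons₃, tokOf] using ih

/-- A block decodes to at most one token. [folklore] -/
theorem length_tokOf_le (a b d : Bool) : (tokOf a b d).length ≤ 1 := by
  cases a <;> cases b <;> cases d <;> simp [tokOf]

/-- Decoding does not lengthen. [folklore] -/
theorem length_decode_le : ∀ z : List Bool, (decode z).length ≤ z.length
  | [] => by simp [decode]
  | [_] => by simp [decode]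
  | [_, _] => by simp [decode]
  | a :: b :: d :: z => by
    rw [decode_cons₃, List.length_append]
    have := length_tokOf_le a b d
    have := length_decode_le z
    simp; omega

end Tok

/-! ### Binary increment as a carry pass -/

namespace TokConv

/-- The bits written by a carry pass over `w` (least significant first) with incoming carry
`c`, final carry excluded. [Knuth 1998, §4.3.1] [folklore] -/
def ib : Bool → List Bool → List Bool
  | _, [] => []
  | c, b :: w => (b ^^ c) :: ib (b && c) w

/-- The outgoing carry of a carry pass. [Knuth 1998, §4.3.1] [folklore] -/
def co : Bool → List Bool → Bool
  | c, [] => c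
  | c, b :: w => co (b && c) w

/-- The result of the increment pass: the written bits and the final carry bit, if set.
[Knuth 1998, §4.3.1] [folklore] -/
def incRes (c : Bool) (w : List Bool) : List Bool := ib c w ++ flag (co c w)

/-- `incRes` on the empty word. [folklore] -/
@[simp] theorem incRes_nil (c : Bool) : incRes c [] = flag c := by simp [incRes, ib, co]

/-- `incRes` on a nonempty word. [folklore] -/
theorem incRes_cons (c b : Bool) (w : List Bool) : incRes c (b :: w) = (b ^^ c) :: incRes (b && c) w := by
  simp [incRes, ib, co]

/-- The value of a flag. [folklore] -/
@[simp] theorem bitsToNat_flag (c : Bool) : bitsToNat (flag c) = c.toNat := by cases c <;> simp [flag]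

/-- **The carry pass adds the carry.** [Knuth 1998, §4.3.1, Algorithm A] [folklore] -/
theorem bitsToNat_incRes : ∀ (c : Bool) (w : List Bool), bitsToNat (incRes c w) = bitsToNat w + c.toNat
  | c, [] => by simp
  | c, b :: w => by
    rw [incRes_cons, bitsToNat_cons, bitsToNat_cons, bitsToNat_incRes]
    cases b <;> cases c <;> simp <;> omega

/-- The carry pass lengthens by at most one. [folklore] -/
theorem length_incRes_le : ∀ (c : Bool) (w : List Bool), (incRes c w).length ≤ w.length + 1
  | c, [] => by cases c <;> simp [flag]
  | c, b :: w => by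
    rw [incRes_cons, List.length_cons, List.length_cons]
    exact Nat.succ_le_succ (length_incRes_le _ w)

/-- `incRes` of a nonempty word is nonempty. [folklore] -/
theorem incRes_ne_nil (c b : Bool) (w : List Bool) : incRes c (b :: w) ≠ [] := by
  rw [incRes_cons]; exact List.cons_ne_nil _ _

/-- The carry pass preserves "not ending in `false`". [folklore] -/
theorem incRes_canonical : ∀ (c : Bool) (w : List Bool), (w = [] ∨ ∃ v, w = v ++ [true]) →
    (incRes c w = [] ∨ ∃ v, incRes c w = v ++ [true])
  | c, [], _ => by cases c <;> simp [flag]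
  | c, b :: w, h => by
    rcases h with h | ⟨v, hv⟩
    · simp at h
    rw [incRes_cons]
    cases v with
    | nil =>
      simp only [List.nil_append, List.cons.injEq] at hv
      obtain ⟨rfl, rfl⟩ := hv
      refine Or.inr ?_
      cases c
      · exact ⟨[], by simp [flag]⟩
      · exact ⟨[false], by simp [flag]⟩
    | cons b' v =>
      simp only [List.cons_append, List.cons.injEq] at hv
      obtain ⟨-, hw⟩ := hv
      subst hw
      rcases incRes_canonical (b && c) (v ++ [true]) (Or.inr ⟨v, rfl⟩) with h0 | ⟨u, hu⟩
      · cases v <;> simp [incRes_cons] at h0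
      · exact Or.inr ⟨(b ^^ c) :: u, by rw [hu]; rfl⟩

/-- **Incrementing Mathlib's binary numeral**: `encodeNat (c + 1)` is the carry pass with
incoming carry over `encodeNat c`. [Knuth 1998, §4.3.1] [folklore] -/
theorem encodeNat_succ_eq_incRes (c : ℕ) : encodeNat (c + 1) = incRes true (encodeNat c) :=
  eq_of_bitsToNat_eq_of_canonical _ _ (encodeNat_canonical _)
    (incRes_canonical _ _ (encodeNat_canonical c)) (by simp [bitsToNat_incRes])

/-- Binary numerals are no longer than their value. [folklore] -/
theorem length_encodeNat_le : ∀ c : ℕ, (encodeNat c).length ≤ c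
  | 0 => by decide
  | c + 1 => by
    rw [encodeNat_succ_eq_incRes]
    exact (length_incRes_le _ _).trans (Nat.succ_le_succ (length_encodeNat_le c))

/-- `encodeNat 0 = []`. [folklore] -/
theorem encodeNat_zero' : encodeNat 0 = [] := by decide

/-! ### The converter program -/

/-- The registers of the converter: input stream, binary counter, scratch, carry flag,
reversed output, result. [folklore] -/
inductive CReg where
  | inp | ctr | tmp | flg | out | res
  deriving DecidableEq, Fintype, Repr


/-- A register file of the converter given register by register. [folklore] -/
def cfile (i c t f o r : List Bool) : Regs CReg
  | .inp => i | .ctr => c | .tmp => t | .flg => f | .out => o | .res => r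

section FileLemmas

variable (i c t f o r v : List Bool)

/-- Reading `inp`. [folklore] -/ @[simp] theorem cfile_inp : cfile i c t f o r .inp = i := rfl
/-- Reading `ctr`. [folklore] -/ @[simp] theorem cfile_ctr : cfile i c t f o r .ctr = c := rfl
/-- Reading `tmp`. [folklore] -/ @[simp] theorem cfile_tmp : cfile i c t f o r .tmp = t := rfl
/-- Reading `flg`. [folklore] -/ @[simp] theorem cfile_flg : cfile i c t f o r .flg = f := rfl
/-- Reading `out`. [folklore] -/ @[simp] theorem cfile_out : cfile i c t f o r .out = o := rfl
/-- Reading `res`. [folklore] -/ @[simp] theorem cfile_res : cfile i c t f o r .res = r := rfl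
/-- Writing `inp`. [folklore] -/
@[simp] theorem update_cfile_inp : Function.update (cfile i c t f o r) .inp v = cfile v c t f o r := by
  funext x; cases x <;> rfl
/-- Writing `ctr`. [folklore] -/
@[simp] theorem update_cfile_ctr : Function.update (cfile i c t f o r) .ctr v = cfile i v t f o r := by
  funext x; cases x <;> rfl
/-- Writing `tmp`. [folklore] -/
@[simp] theorem update_cfile_tmp : Function.update (cfile i c t f o r) .tmp v = cfile i c v f o r := by
  funext x; cases x <;> rfl
/-- Writing `flg`. [folklore] -/
@[simp] theorem update_cfile_flg : Function.update (cfile i c t f o r) .flg v = cfile i c t v o r := by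
  funext x; cases x <;> rfl
/-- Writing `out`. [folklore] -/
@[simp] theorem update_cfile_out : Function.update (cfile i c t f o r) .out v = cfile i c t f v r := by
  funext x; cases x <;> rfl
/-- Writing `res`. [folklore] -/
@[simp] theorem update_cfile_res : Function.update (cfile i c t f o r) .res v = cfile i c t f o v := by
  funext x; cases x <;> rfl

end FileLemmas

/-- The initial register file of the converter. [folklore] -/
theorem init_eq (z : List Bool) : Regs.init CReg.inp z = cfile z [] [] [] [] [] := by
  funext x; cases x <;> rfl

open Com

/-- One step of the carry pass on the popped counter bit `b`: with carry (flag set) write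
`¬b` and keep the carry iff `b`; without carry copy `b`. [Knuth 1998, §4.3.1] [folklore] -/
def incBody (b : Bool) : Com CReg :=
  pop .flg (push .tmp (!b) ;; bif b then push .flg true else skip) skip (push .tmp b)

/-- The carry loop over the counter. [folklore] -/
def incLoop : Com CReg := loop .ctr (incBody true) (incBody false)

/-- **Increment** of the binary counter: carry pass into `tmp` (most significant bit on top),
final carry, pour back (least significant bit on top again). [Knuth 1998, §4.3.1] [folklore] -/
def inc : Com CReg :=
  push .flg true ;; incLoop ;; pop .flg (push .tmp true) skip skip ;; pour .tmp .ctr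

/-- One step of the carry pass. [folklore] -/
theorem runs_incBody (b cr : Bool) (i w t o r : List Bool) :
    Runs (incBody b) (cfile i w t (flag cr) o r) (cfile i w ((b ^^ cr) :: t) (flag (b && cr)) o r) 4 := by
  cases cr
  · refine (Runs.pop_nil _ _ (by rfl) (Runs.push' (R' := cfile i w (b :: t) (flag false) o r)
      (by simp))).of_eq (by cases b <;> rfl) (by omega)
  · cases b
    · refine (Runs.pop_true' _ _ (w := []) (by rfl) (update_cfile_flg _ _ _ _ _ _ _)
        ((Runs.push' (R' := cfile i w (true :: t) [] o r) (by simp)).seq (Runs.skip _))).of_eq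
        (by rfl) (by omega)
    · refine (Runs.pop_true' _ _ (w := []) (by rfl) (update_cfile_flg _ _ _ _ _ _ _)
        ((Runs.push' (R' := cfile i w (false :: t) [] o r) (by simp)).seq
          (Runs.push' (R' := cfile i w (false :: t) [true] o r) (by simp)))).of_eq
        (by rfl) (by omega)

/-- The carry loop. [folklore] -/
theorem runs_incLoop : ∀ (w : List Bool) (cr : Bool) (i t o r : List Bool),
    Runs incLoop (cfile i w t (flag cr) o r) (cfile i [] ((ib cr w).reverse ++ t) (flag (co cr w)) o r)
      (6 * w.length + 1)
  | [], cr, i, t, o, r =>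
    (Runs.loop_nil (incBody true) (incBody false) (R := cfile i [] t (flag cr) o r) rfl).of_eq
      (by simp [ib, co]) (by simp)
  | b :: w, cr, i, t, o, r => by
    have h1 := runs_incBody b cr i w t o r
    have h2 := runs_incLoop w (b && cr) i ((b ^^ cr) :: t) o r
    have e : (ib (b && cr) w).reverse ++ (b ^^ cr) :: t = (ib cr (b :: w)).reverse ++ t := by simp [ib]
    rw [e, show co (b && cr) w = co cr (b :: w) from rfl] at h2
    cases b
    · exact (Runs.loop_false' (by rfl) (update_cfile_ctr _ _ _ _ _ _ _) h1 h2).of_eq rfl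
        (by simp; omega)
    · exact (Runs.loop_true' (by rfl) (update_cfile_ctr _ _ _ _ _ _ _) h1 h2).of_eq rfl
        (by simp; omega)

/-- **The increment program replaces `encodeNat c` by `encodeNat (c + 1)`**, in at most
`9 |encodeNat c| + 9` steps. [Knuth 1998, §4.3.1] [folklore] -/
theorem runs_inc (c : ℕ) (i o r : List Bool) :
    Runs inc (cfile i (encodeNat c) [] [] o r) (cfile i (encodeNat (c + 1)) [] [] o r)
      (9 * (encodeNat c).length + 9) := by
  set w := encodeNat c with hw
  have h0 : Runs (push CReg.flg true) (cfile i w [] [] o r) (cfile i w [] (flag true) o r) 1 :=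
    Runs.push' (by simp)
  have h1 := runs_incLoop w true i [] o r
  rw [List.append_nil] at h1
  have h2 : Runs (pop CReg.flg (push CReg.tmp true) skip skip)
      (cfile i [] (ib true w).reverse (flag (co true w)) o r)
      (cfile i [] ((incRes true w).reverse) [] o r) 3 := by
    cases hco : co true w
    · refine (Runs.pop_nil _ _ (by simp) (Runs.skip _)).of_eq ?_ (by omega)
      simp [incRes, hco, flag]
    · refine (Runs.pop_true' _ _ (w := []) (by simp) (update_cfile_flg _ _ _ _ _ _ _)
        (Runs.push' (R' := cfile i [] (true :: (ib true w).reverse) [] o r) (by simp))).of_eq ?_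
        (by omega)
      simp [incRes, hco, flag]
  have h3 := runs_pour (a := CReg.tmp) (b := CReg.ctr) (by decide)
    (cfile i [] ((incRes true w).reverse) [] o r)
  simp only [cfile_tmp, cfile_ctr, List.reverse_reverse, List.append_nil, update_cfile_tmp,
    update_cfile_ctr, List.length_reverse] at h3
  refine (h0.seq (h1.seq (h2.seq h3))).of_eq (by rw [encodeNat_succ_eq_incRes]) ?_
  have := length_incRes_le true w
  omega

/-- **Dump**: pop the counter bit by bit, pushing each bit `m` times on the output.
[folklore] -/
def dumpProg (m : ℕ) : Com CReg :=
  loop .ctr (GenProg.pushes .out (List.replicate m true)) (GenProg.pushes .out (List.replicate m false))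

/-- Effect of `dumpProg`: the output receives the reversed repeated-bit numeral, the counter is
emptied, in `(m + 2)|w| + 1` steps. [folklore] -/
theorem runs_dump (m : ℕ) : ∀ (w i t f o r : List Bool),
    Runs (dumpProg m) (cfile i w t f o r)
      (cfile i [] t f ((w.flatMap fun b => List.replicate m b).reverse ++ o) r) ((m + 2) * w.length + 1)
  | [], i, t, f, o, r =>
    (Runs.loop_nil (GenProg.pushes CReg.out (List.replicate m true))
      (GenProg.pushes CReg.out (List.replicate m false)) (R := cfile i [] t f o r) rfl).of_eq
      (by simp) (by simp)
  | b :: w, i, t, f, o, r => by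
    have h1 : ∀ b : Bool, Runs (GenProg.pushes CReg.out (List.replicate m b)) (cfile i w t f o r)
        (cfile i w t f (List.replicate m b ++ o) r) m := fun b => by
      simpa using GenProg.runs_pushes CReg.out (List.replicate m b) (cfile i w t f o r)
    have h2 := fun b : Bool => runs_dump m w i t f (List.replicate m b ++ o) r
    have e : ∀ b : Bool, ((w.flatMap fun b => List.replicate m b).reverse ++ (List.replicate m b ++ o)) =
        ((b :: w).flatMap fun b => List.replicate m b).reverse ++ o := fun b => by simp
    cases b
    · refine (Runs.loop_false' (by rfl) (update_cfile_ctr _ _ _ _ _ _ _) (h1 false) (h2 false)).of_eq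
        (by rw [e]) ?_
      simp; ring_nf; omega
    · refine (Runs.loop_true' (by rfl) (update_cfile_ctr _ _ _ _ _ _ _) (h1 true) (h2 true)).of_eq
        (by rw [e]) ?_
      simp; ring_nf; omega

/-- The handler of a decoded block `a b d` (cf. `Tok.tokOf`): literal, increment, nothing, dump.
[folklore] -/
def handler : Bool → Bool → Bool → Com CReg
  | false, false, b => push .out b
  | false, true, false => inc
  | false, true, true => skip
  | true, b₁, b₀ => dumpProg (Tok.mult b₁ b₀)

/-- Dispatch on the third bit. [folklore] -/
def disp2 (a b : Bool) : Com CReg := pop .inp (handler a b true) (handler a b false) skip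

/-- Dispatch on the second bit. [folklore] -/
def disp1 (a : Bool) : Com CReg := pop .inp (disp2 a true) (disp2 a false) skip

/-- The main loop: dispatch on the first bit of each block until the input is exhausted.
[folklore] -/
def mainLoop : Com CReg := loop .inp (disp1 true) (disp1 false)

/-- **The converter**: main loop, then pour the reversed output into the result register.
[folklore] -/
def conv : Com CReg := mainLoop ;; pour .out .res

/-- The effect of a handler on the state `(counter c, output o)`: the token semantics of
`Tok.render`/`Tok.fin` for the block `a b d`. [folklore] -/
theorem runs_handler (a b d : Bool) (c : ℕ) (i o r : List Bool) :
    Runs (handler a b d) (cfile i (encodeNat c) [] [] o r)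
      (cfile i (encodeNat (Tok.fin c (Tok.tokOf a b d))) [] []
        ((Tok.render c (Tok.tokOf a b d)).reverse ++ o) r) (9 * c + 9) := by
  have hl := length_encodeNat_le c
  cases a
  · cases b
    · -- literal
      refine (Runs.push' (R' := cfile i (encodeNat c) [] [] (d :: o) r) (by simp)).of_eq
        (by simp [Tok.tokOf]) (by omega)
    · cases d
      · -- tick
        refine (runs_inc c i o r).of_eq (by simp [Tok.tokOf]) ?_
        omega
      · -- unused block
        exact (Runs.skip _).of_eq (by simp [Tok.tokOf]) (by omega)
  · -- dump
    refine (runs_dump (Tok.mult b d) (encodeNat c) i [] [] o r).of_eq ?_ ?_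
    · simp [Tok.tokOf, Tok.numeral, encodeNat_zero']
    · have := Tok.mult_le b d
      have : (Tok.mult b d + 2) * (encodeNat c).length ≤ 6 * c :=
        (Nat.mul_le_mul (by omega) hl)
      omega

/-- The exact-shape cost recursion of the main loop (bounded in `mainCost_le`). [folklore] -/
def mainCost : ℕ → List Bool → ℕ
  | c, a :: b :: d :: z => (9 * c + 15) + mainCost (Tok.fin c (Tok.tokOf a b d)) z
  | _, [_, _] => 7
  | _, [_] => 5
  | _, [] => 1

/-- The cost recursion on a full block. [folklore] -/
theorem mainCost_cons₃ (c : ℕ) (a b d : Bool) (z : List Bool) :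
    mainCost c (a :: b :: d :: z) = (9 * c + 15) + mainCost (Tok.fin c (Tok.tokOf a b d)) z := rfl

/-- A block moves the counter by at most one. [folklore] -/
theorem fin_tokOf_le (c : ℕ) (a b d : Bool) : Tok.fin c (Tok.tokOf a b d) ≤ c + 1 := by
  cases a <;> cases b <;> cases d <;> simp [Tok.tokOf]

/-- **The main loop cost is quadratic**: at most `(9 (c + |z|) + 15) |z| + 7`. [folklore] -/
theorem mainCost_le : ∀ (c : ℕ) (z : List Bool), mainCost c z ≤ (9 * (c + z.length) + 15) * z.length + 7
  | c, a :: b :: d :: z => by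
    rw [mainCost_cons₃]
    have ih := mainCost_le (Tok.fin c (Tok.tokOf a b d)) z
    have hf := fin_tokOf_le c a b d
    have h1 : (9 * (Tok.fin c (Tok.tokOf a b d) + z.length) + 15) * z.length ≤
        (9 * (c + (a :: b :: d :: z).length) + 15) * z.length :=
      Nat.mul_le_mul_right _ (by simp; omega)
    have h2 : (9 * (c + (a :: b :: d :: z).length) + 15) * z.length + (9 * c + 15) + 7 ≤
        (9 * (c + (a :: b :: d :: z).length) + 15) * (a :: b :: d :: z).length + 7 := by
      simp only [List.length_cons]
      nlinarith
    omega
  | _, [_, _] => by simp [mainCost]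
  | _, [_] => by simp [mainCost]
  | _, [] => by simp [mainCost]

/-- **The main loop renders the decoded stream** (reversed, onto the output register), leaving
the counter at `encodeNat (fin c (decode z))`. [folklore] -/
theorem runs_mainLoop : ∀ (z : List Bool) (c : ℕ) (o r : List Bool),
    Runs mainLoop (cfile z (encodeNat c) [] [] o r)
      (cfile [] (encodeNat (Tok.fin c (Tok.decode z))) [] [] ((Tok.render c (Tok.decode z)).reverse ++ o) r)
      (mainCost c z)
  | [], c, o, r =>
    (Runs.loop_nil (disp1 true) (disp1 false) (R := cfile [] (encodeNat c) [] [] o r) rfl).of_eq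
      (by simp [Tok.decode]) (by simp [mainCost])
  | [a], c, o, r => by
    have h1 : Runs (disp1 a) (cfile [] (encodeNat c) [] [] o r) (cfile [] (encodeNat c) [] [] o r) 2 :=
      (Runs.pop_nil _ _ (by rfl) (Runs.skip _)).of_eq rfl (by omega)
    have h2 : Runs mainLoop (cfile [] (encodeNat c) [] [] o r) (cfile [] (encodeNat c) [] [] o r) 1 :=
      Runs.loop_nil _ _ (by rfl)
    cases a
    · exact (Runs.loop_false' (by rfl) (update_cfile_inp _ _ _ _ _ _ _) h1 h2).of_eq
        (by simp [Tok.decode]) (by simp [mainCost])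
    · exact (Runs.loop_true' (by rfl) (update_cfile_inp _ _ _ _ _ _ _) h1 h2).of_eq
        (by simp [Tok.decode]) (by simp [mainCost])
  | [a, b], c, o, r => by
    have h0 : ∀ a b : Bool, Runs (disp2 a b) (cfile [] (encodeNat c) [] [] o r)
        (cfile [] (encodeNat c) [] [] o r) 2 := fun a b =>
      (Runs.pop_nil _ _ (by rfl) (Runs.skip _)).of_eq rfl (by omega)
    have h1 : Runs (disp1 a) (cfile [b] (encodeNat c) [] [] o r) (cfile [] (encodeNat c) [] [] o r) 4 := by
      cases b
      · exact (Runs.pop_false' _ _ (by rfl) (update_cfile_inp _ _ _ _ _ _ _) (h0 a false)).of_eq rfl le_rfl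
      · exact (Runs.pop_true' _ _ (by rfl) (update_cfile_inp _ _ _ _ _ _ _) (h0 a true)).of_eq rfl le_rfl
    have h2 : Runs mainLoop (cfile [] (encodeNat c) [] [] o r) (cfile [] (encodeNat c) [] [] o r) 1 :=
      Runs.loop_nil _ _ (by rfl)
    cases a
    · exact (Runs.loop_false' (by rfl) (update_cfile_inp _ _ _ _ _ _ _) h1 h2).of_eq
        (by simp [Tok.decode]) (by simp [mainCost])
    · exact (Runs.loop_true' (by rfl) (update_cfile_inp _ _ _ _ _ _ _) h1 h2).of_eq
        (by simp [Tok.decode]) (by simp [mainCost])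
  | a :: b :: d :: z, c, o, r => by
    -- the handler, then the rest of the loop
    set c' := Tok.fin c (Tok.tokOf a b d) with hc'
    set o' := (Tok.render c (Tok.tokOf a b d)).reverse ++ o with ho'
    have hh := runs_handler a b d c z o r
    have ih := runs_mainLoop z c' o' r
    have h2 : Runs (disp2 a b) (cfile (d :: z) (encodeNat c) [] [] o r) (cfile z (encodeNat c') [] [] o' r)
        (9 * c + 9 + 2) := by
      cases d
      · exact Runs.pop_false' _ _ (by rfl) (update_cfile_inp _ _ _ _ _ _ _) hh
      · exact Runs.pop_true' _ _ (by rfl) (update_cfile_inp _ _ _ _ _ _ _) hh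
    have h1 : Runs (disp1 a) (cfile (b :: d :: z) (encodeNat c) [] [] o r) (cfile z (encodeNat c') [] [] o' r)
        (9 * c + 9 + 2 + 2) := by
      cases b
      · exact Runs.pop_false' _ _ (by rfl) (update_cfile_inp _ _ _ _ _ _ _) h2
      · exact Runs.pop_true' _ _ (by rfl) (update_cfile_inp _ _ _ _ _ _ _) h2
    have e1 : Tok.fin c (Tok.decode (a :: b :: d :: z)) = Tok.fin c' (Tok.decode z) := by
      rw [Tok.decode_cons₃, Tok.fin_append]
    have e2 : (Tok.render c (Tok.decode (a :: b :: d :: z))).reverse ++ o =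
        (Tok.render c' (Tok.decode z)).reverse ++ o' := by
      rw [Tok.decode_cons₃, Tok.render_append, List.reverse_append, List.append_assoc]
    rw [e1, e2]
    cases a
    · exact (Runs.loop_false' (by rfl) (update_cfile_inp _ _ _ _ _ _ _) h1 ih).of_eq rfl
        (by show _ ≤ 9 * c + 15 + mainCost c' z; omega)
    · exact (Runs.loop_true' (by rfl) (update_cfile_inp _ _ _ _ _ _ _) h1 ih).of_eq rfl
        (by show _ ≤ 9 * c + 15 + mainCost c' z; omega)

/-- Rendered streams are short: `|render c ts| ≤ 4 (c + |ts|)`. [folklore] -/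
theorem length_render_le : ∀ (c : ℕ) (ts : List Tok), (Tok.render c ts).length ≤ 4 * (c + ts.length)
  | c, [] => by simp
  | c, Tok.lit b :: ts => by
    have := length_render_le c ts
    simp; omega
  | c, Tok.tick :: ts => by
    have := length_render_le (c + 1) ts
    simp; omega
  | c, Tok.dump b₁ b₀ :: ts => by
    have := length_render_le 0 ts
    have hm := Tok.mult_le b₁ b₀
    have hl := length_encodeNat_le c
    have hn : (Tok.numeral (Tok.mult b₁ b₀) c).length ≤ 4 * c := by
      simp only [Tok.numeral, List.length_flatMap, List.length_replicate, List.map_const',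
        List.sum_replicate, smul_eq_mul]
      exact (Nat.mul_le_mul hl hm).trans (by omega)
    simp; omega

/-- **The converter computes `z ↦ render 0 (decode z)`** within `9|z|² + 28|z| + 8` steps.
[folklore] -/
theorem runs_conv (z : List Bool) :
    Runs conv (cfile z [] [] [] [] []) (cfile [] (encodeNat (Tok.fin 0 (Tok.decode z))) [] [] []
      (Tok.render 0 (Tok.decode z))) (9 * z.length * z.length + 28 * z.length + 8) := by
  have h1 := runs_mainLoop z 0 [] []
  rw [encodeNat_zero'] at h1
  simp only [List.append_nil] at h1
  have h2 := runs_pour (a := CReg.out) (b := CReg.res) (by decide)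
    (cfile [] (encodeNat (Tok.fin 0 (Tok.decode z))) [] [] (Tok.render 0 (Tok.decode z)).reverse [])
  simp only [cfile_out, cfile_res, List.reverse_reverse, List.append_nil, update_cfile_out,
    update_cfile_res, List.length_reverse] at h2
  refine (h1.seq h2).mono ?_
  have hc := mainCost_le 0 z
  have hr := length_render_le 0 (Tok.decode z)
  have hd := Tok.length_decode_le z
  simp only [Nat.zero_add] at hc hr
  have : (9 * z.length + 15) * z.length = 9 * z.length * z.length + 15 * z.length := by ring
  omega

end TokConv

/-! ### `FP` results -/

open Polynomial in
/-- **Rendering the decoded stream is polynomial time**: `z ↦ render 0 (decode z) ∈ FP`.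
[Arora–Barak 2009, §1.3] [folklore] -/
theorem Tok.render_decode_mem_FP : (fun z => Tok.render 0 (Tok.decode z)) ∈ FP := by
  refine Com.mem_FP TokConv.conv TokConv.CReg.inp TokConv.CReg.res (9 * X ^ 2 + 28 * X + 8) _ fun z =>
    ⟨TokConv.cfile [] (encodeNat (Tok.fin 0 (Tok.decode z))) [] [] [] (Tok.render 0 (Tok.decode z)),
      Or.inl ?_, rfl⟩
  rw [TokConv.init_eq]
  refine (TokConv.runs_conv z).mono (le_of_eq ?_)
  simp [sq]; ring

/-- **Generator programs print rendered descriptions in polynomial time.** For a generator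
program `s` over the token alphabet (loop indices avoiding the input variable `x₀`, not reused),
the rendered stream `z ↦ render 0 (out s (x₀ ↦ |z|))` — literal bits, and binary numerals of
unary-counted quantities — is in `FP`. [Arora–Barak 2009, §6.2 and proof of Thm. 6.15]
[folklore] -/
theorem GStmt.render_out_mem_FP {V : Type} [DecidableEq V] [Fintype V] (s : GStmt V Tok) (x₀ : V)
    (hx : x₀ ∉ s.loopVars) (hs : s.noReuse = true) :
    (fun z => Tok.render 0 (s.out (GenProg.initEnv x₀ z.length))) ∈ FP := by
  have h1 := s.out_mem_FP Tok.code x₀ hx hs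
  have h2 := PolyTimeComputable.comp_holds Tok.render_decode_mem_FP h1
  have e : ((fun z : List Bool => Tok.render 0 (Tok.decode z)) ∘ fun z : List Bool =>
      (s.out (GenProg.initEnv x₀ z.length)).flatMap Tok.code) =
      fun z : List Bool => Tok.render 0 (s.out (GenProg.initEnv x₀ z.length)) := by
    funext z; simp [Tok.decode_code]
  rw [e] at h2
  exact h2

end Literature.Computability.Complexity
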